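import Literature.NumberTheory.CubicFields.ThreeTorsionMeanDecomposition
import Literature.NumberTheory.QuadraticFields.ThreeTorsionMeanLocalAtThreeProofs
import HarnessLib

/-!
# Bhargava–Varma Cor. 4 (b) at `3` (`bv_threeTorsion_mean_localAtThree`) on genuine objects: reduction
# to the CFT dictionary and ONE count of cubic fields with a local condition at `3`

Topic `Literature/NumberTheory/CubicFields` × `QuadraticFields`. Theorem-only file (no definition,
no named fact, D-0026): it instantiates the quadratic-side assembly of Bhargava–Varma §5.3
(`QuadraticFields/ThreeTorsionMeanLocalAtThreeProofs.lean`: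
`bv_threeTorsion_mean_localAtThree_of_cubicCount` and its converse
`tendsto_cubicCount_div_of_bv_threeTorsion_mean_localAtThree`, stated there for an abstract count
`c : ℤ → ℕ` under the dictionary `#Cl₃(D) = 2·c(D) + 1`) with the tree's genuine objects

* `cubicFieldCountOfDisc D` — the number of cubic fields of discriminant `D` up to isomorphism
  (`ThreeTorsionBridge.lean`), and
* the named fact `threeTorsion_eq_two_mul_cubicFieldCountOfDisc_add_one` — the class-field-theoretic
  dictionary `#Cl(ℚ(√D))[3] = 2 · cubicFieldCountOfDisc D + 1` on fundamental `D` (Hasse; BST §8.5;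
  in Bhargava–Varma it is Prop. 35 (ring class field duality) at maximal orders, entering the proof
  of Cor. 4 through display (pont): `2·N(X, Σ) = Σ_{𝒪 ∈ Σ, 0<Disc 𝒪<X} (#Cl₃(𝒪) − 1)`),
  `ThreeTorsionMeanDecomposition.lean`,

exactly as `ThreeTorsionBridge.lean` does for `btt_threeTorsion_sum`. Printed proof being followed
(Bhargava–Varma, Proc. LMS 112 (2016) = arXiv:1401.5875, §5.3–5.4, pp. 20–22 of the held text):
for an acceptable family `Σ` of quadratic orders, `N^{(i)}(X, Σ) = Σ_c N₃(Σ^{(3),c}, X/c²)` counts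
cubic fields whose quadratic resolvent ring is a `Σ`-order (display (nisigma)); Theorem 36 (= [BST],
cubic fields with local specifications) gives `lim N^{(i)}(X,Σ)/X`; (pont) converts to `#Cl₃`; the
last display of §5.3 is `mean = 1 + lim 2N/#`. For MAXIMAL orders (§5.4, Cor. 4) only `c = 1`
occurs, `N^{(0)}(X, Σ) = Σ_{0<D<X, D ∈ Σ} #{cubic fields K : Disc K = D}`, and Lemma 38
(`C(R) = 1/2`) makes the mean `1 + 2/n₀ = 4/3` (`n₀ = 6`).

Contents (all PROVED):

* `bv_threeTorsion_mean_localAtThree_of_hasse_of_cubicFieldCount` — the dictionary (named fact,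
  hypothesis) and the two limits
  `(Σ_{0<D<X fund., 3 ∣ D} cubicFieldCountOfDisc D)/X → 1/(8π²)`,
  `(Σ_{0<D<X fund., 3 ∤ D} cubicFieldCountOfDisc D)/X → 3/(8π²)` (Theorem 36 for totally real cubic
  fields nowhere totally ramified with `3` partially ramified, resp. `3` unramified:
  `(1/(2·6)) · Π_p (…)` with the factor at `3` equal to `(2/3)·(1/3)`, resp. `(2/3)·1`, against
  `(2/3)·(4/3) = 1 − 1/9` without condition — one quarter, resp. three quarters, of the total
  `1/(2π²)` of BTT display (3)) imply `bv_threeTorsion_mean_localAtThree`;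
* `tendsto_cubicFieldCountOfDisc_div_of_bv_threeTorsion_mean_localAtThree` — conversely the fact
  and the dictionary force these two limits (the constants are not a choice);
* `tendsto_sum_posFundDiscrs_cubicFieldCountOfDisc_div` — the second child
  `btt_fundCubicFieldCount_sum` of `btt_threeTorsion_sum` (BTT display (3), named fact, hypothesis)
  gives the total `(Σ_{0<D<X fund.} cubicFieldCountOfDisc D)/X → 1/(2π²)`, whence
  `tendsto_cubicFieldCountOfDisc_not_three_dvd_of_three_dvd` / `…_three_dvd_of_not_three_dvd`:
  either local limit at `3` determines the other;
* `bv_threeTorsion_mean_localAtThree_of_hasse_of_btt_of_three_dvd` — **the residual form**: the two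
  existing named facts `threeTorsion_eq_two_mul_cubicFieldCountOfDisc_add_one`,
  `btt_fundCubicFieldCount_sum` and the SINGLE local count
  `#{totally real cubic fields K : 0 < Disc K < X fundamental, 3 ∣ Disc K} = X/(8π²) + o(X)`
  (Theorem 36 = [BST, Thm 8] at the one prime `3`; not a named fact of the tree) imply
  `bv_threeTorsion_mean_localAtThree`.

## References

* M. Bhargava, I. Varma, *The mean number of 3-torsion elements in the class groups and ideal
  groups of quadratic orders*, Proc. London Math. Soc. (3) 112 (2016) 235–266 = arXiv:1401.5875:
  Cor. 4, Prop. 35, Thm 36, §5.3 displays (nisigma), (pont) and the last display, §5.4 Lemma 38.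
  [BhargavaVarma2016]
* M. Bhargava, A. Shankar, J. Tsimerman, *On the Davenport–Heilbronn theorems and second order
  terms*, Invent. Math. 193 (2013) 439–499 = arXiv:1005.0672, Thm 8, §8.5. [BhargavaShankarTsimerman2012]
* M. Bhargava, T. Taniguchi, F. Thorne, *Improved error estimates for the Davenport–Heilbronn
  theorems*, Math. Ann. 389 (2024) = arXiv:2107.12819, display (3). [BhargavaTaniguchiThorne2023]
-/

noncomputable section

open Finset Filter
open scoped Topology

namespace Literature.NumberTheory.CubicFields

open Literature.NumberTheory.QuadraticFields

/-! ### The dictionary on the positive fundamental discriminants below `X` -/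

/-- The named fact `threeTorsion_eq_two_mul_cubicFieldCountOfDisc_add_one` restricted to
`posFundDiscrs X` — the shape of the hypothesis `hc` of
`bv_threeTorsion_mean_localAtThree_of_cubicCount`. [cite: BhargavaShankarTsimerman2012, §8.5] -/
theorem threeTorsion_eq_of_hasse_posFundDiscrs
    (h₁ : threeTorsion_eq_two_mul_cubicFieldCountOfDisc_add_one) :
    ∀ X : ℕ, ∀ D ∈ posFundDiscrs X, quadFieldThreeTorsion D = 2 * cubicFieldCountOfDisc D + 1 :=
  fun _ D hD => h₁ D (mem_posFundDiscrs.1 hD).2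

/-! ### Cor. 4 (b) at `3` from the dictionary and the two local counts of cubic fields -/

/-- **Bhargava–Varma, Cor. 4 (b) at the prime `3`, on genuine objects.** Assume the
class-field-theoretic dictionary `#Cl₃(D) = 2 · cubicFieldCountOfDisc D + 1` on fundamental `D`
(the named fact `threeTorsion_eq_two_mul_cubicFieldCountOfDisc_add_one`; Prop. 35 at maximal orders,
display (pont)) and the two counts of totally real cubic fields of fundamental discriminant with a
local condition at `3` (Thm 36 through (nisigma) with `c = 1`):
`(Σ_{0<D<X fund., 3 ∣ D} cubicFieldCountOfDisc D)/X → 1/(8π²)` and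
`(Σ_{0<D<X fund., 3 ∤ D} cubicFieldCountOfDisc D)/X → 3/(8π²)`. Then
`bv_threeTorsion_mean_localAtThree` holds (both means are `1 + 2·(1/6) = 4/3`, last display of
§5.3 with Lemma 38). [cite: BhargavaVarma2016, §5.3–5.4 (proof of Cor. 4: (nisigma), Thm 36, (pont), Lemma 38)] -/
theorem bv_threeTorsion_mean_localAtThree_of_hasse_of_cubicFieldCount
    (h₁ : threeTorsion_eq_two_mul_cubicFieldCountOfDisc_add_one)
    (hram : Tendsto (fun X : ℕ =>
      (∑ D ∈ (posFundDiscrs X).filter (fun D => (3 : ℤ) ∣ D), (cubicFieldCountOfDisc D : ℝ)) /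
        (X : ℝ)) atTop (𝓝 (1 / (8 * Real.pi ^ 2))))
    (hunr : Tendsto (fun X : ℕ =>
      (∑ D ∈ (posFundDiscrs X).filter (fun D => ¬ (3 : ℤ) ∣ D), (cubicFieldCountOfDisc D : ℝ)) /
        (X : ℝ)) atTop (𝓝 (3 / (8 * Real.pi ^ 2)))) :
    bv_threeTorsion_mean_localAtThree :=
  bv_threeTorsion_mean_localAtThree_of_cubicCount (threeTorsion_eq_of_hasse_posFundDiscrs h₁) hram hunr

/-- **Conversely, the fact and the dictionary pin down the two local counts of cubic fields**:
`(Σ_{0<D<X fund., 3 ∣ D} cubicFieldCountOfDisc D)/X → 1/(8π²)` and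
`(Σ_{0<D<X fund., 3 ∤ D} cubicFieldCountOfDisc D)/X → 3/(8π²)` ((pont) read backwards with the
proved densities `3/(4π²)`, `9/(4π²)` of the two families of discriminants).
[cite: BhargavaVarma2016, §5.3 (display (pont) and the last display)] -/
theorem tendsto_cubicFieldCountOfDisc_div_of_bv_threeTorsion_mean_localAtThree
    (h₁ : threeTorsion_eq_two_mul_cubicFieldCountOfDisc_add_one)
    (h : bv_threeTorsion_mean_localAtThree) :
    Tendsto (fun X : ℕ =>
      (∑ D ∈ (posFundDiscrs X).filter (fun D => (3 : ℤ) ∣ D), (cubicFieldCountOfDisc D : ℝ)) /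
        (X : ℝ)) atTop (𝓝 (1 / (8 * Real.pi ^ 2))) ∧
    Tendsto (fun X : ℕ =>
      (∑ D ∈ (posFundDiscrs X).filter (fun D => ¬ (3 : ℤ) ∣ D), (cubicFieldCountOfDisc D : ℝ)) /
        (X : ℝ)) atTop (𝓝 (3 / (8 * Real.pi ^ 2))) :=
  tendsto_cubicCount_div_of_bv_threeTorsion_mean_localAtThree
    (threeTorsion_eq_of_hasse_posFundDiscrs h₁) h

/-! ### The total count of cubic fields of positive fundamental discriminant (BTT display (3)) -/

/-- **From the two-term asymptotic (3) to the density**: the named fact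
`btt_fundCubicFieldCount_sum` (BTT display (3), real case:
`N⁺_{3,fund}(X) = X/(2π²) + K X^{5/6} + O_ε(X^{2/3+ε})`) gives
`(Σ_{0<D<X fund.} cubicFieldCountOfDisc D)/X → 1/(2π²)` (take `ε = 1/12` and divide by `X`).
[cite: BhargavaTaniguchiThorne2023, display (3) p. 3] -/
theorem tendsto_sum_posFundDiscrs_cubicFieldCountOfDisc_div (h₂ : btt_fundCubicFieldCount_sum) :
    Tendsto (fun X : ℕ => (∑ D ∈ posFundDiscrs X, (cubicFieldCountOfDisc D : ℝ)) / (X : ℝ))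
      atTop (𝓝 (1 / (2 * Real.pi ^ 2))) := by
  obtain ⟨K, hK⟩ := h₂.2
  obtain ⟨C, hC⟩ := hK (1 / 12) (by norm_num)
  have he : (2 : ℝ) / 3 + 1 / 12 = 3 / 4 := by norm_num
  simp only [he] at hC
  -- divide by the trivial count `N X = X` (`d = 1`, error `0 · √X`)
  have h := tendsto_div_of_two_term_asymptotics (S := fun X : ℕ =>
      ∑ D ∈ posFundDiscrs X, (cubicFieldCountOfDisc D : ℝ)) (N := fun X : ℕ => (X : ℝ))
    (c := 1 / (2 * Real.pi ^ 2)) (d := 1) (K := K) (C₁ := C) (C₂ := 0) one_pos hC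
    (fun X => by simp)
  simpa using h

/-- **Splitting the total at `3`**: for every `X`,
`Σ_{0<D<X fund.} c(D) = Σ_{3 ∣ D} c(D) + Σ_{3 ∤ D} c(D)`. [folklore] -/
theorem sum_posFundDiscrs_eq_sum_filter_three_dvd_add (c : ℤ → ℝ) (X : ℕ) :
    ∑ D ∈ posFundDiscrs X, c D =
      ∑ D ∈ (posFundDiscrs X).filter (fun D => (3 : ℤ) ∣ D), c D +
        ∑ D ∈ (posFundDiscrs X).filter (fun D => ¬ (3 : ℤ) ∣ D), c D :=
  (Finset.sum_filter_add_sum_filter_not _ _ _).symm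

/-- **Either local count at `3` determines the other** (given the total (3)): if
`(Σ_{3 ∣ D} cubicFieldCountOfDisc D)/X → 1/(8π²)` then
`(Σ_{3 ∤ D} cubicFieldCountOfDisc D)/X → 3/(8π²) = 1/(2π²) − 1/(8π²)`.
[cite: BhargavaTaniguchiThorne2023, display (3) p. 3] -/
theorem tendsto_cubicFieldCountOfDisc_not_three_dvd_of_three_dvd (h₂ : btt_fundCubicFieldCount_sum)
    (hram : Tendsto (fun X : ℕ =>
      (∑ D ∈ (posFundDiscrs X).filter (fun D => (3 : ℤ) ∣ D), (cubicFieldCountOfDisc D : ℝ)) /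
        (X : ℝ)) atTop (𝓝 (1 / (8 * Real.pi ^ 2)))) :
    Tendsto (fun X : ℕ =>
      (∑ D ∈ (posFundDiscrs X).filter (fun D => ¬ (3 : ℤ) ∣ D), (cubicFieldCountOfDisc D : ℝ)) /
        (X : ℝ)) atTop (𝓝 (3 / (8 * Real.pi ^ 2))) := by
  have h := (tendsto_sum_posFundDiscrs_cubicFieldCountOfDisc_div h₂).sub hram
  rw [show 1 / (2 * Real.pi ^ 2) - 1 / (8 * Real.pi ^ 2) = 3 / (8 * Real.pi ^ 2) by ring] at h
  refine h.congr fun X => ?_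
  rw [sum_posFundDiscrs_eq_sum_filter_three_dvd_add (fun D => (cubicFieldCountOfDisc D : ℝ)) X]
  ring

/-- Symmetrically: if `(Σ_{3 ∤ D} cubicFieldCountOfDisc D)/X → 3/(8π²)` then
`(Σ_{3 ∣ D} cubicFieldCountOfDisc D)/X → 1/(8π²)`. [cite: BhargavaTaniguchiThorne2023, display (3) p. 3] -/
theorem tendsto_cubicFieldCountOfDisc_three_dvd_of_not_three_dvd (h₂ : btt_fundCubicFieldCount_sum)
    (hunr : Tendsto (fun X : ℕ =>
      (∑ D ∈ (posFundDiscrs X).filter (fun D => ¬ (3 : ℤ) ∣ D), (cubicFieldCountOfDisc D : ℝ)) /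
        (X : ℝ)) atTop (𝓝 (3 / (8 * Real.pi ^ 2)))) :
    Tendsto (fun X : ℕ =>
      (∑ D ∈ (posFundDiscrs X).filter (fun D => (3 : ℤ) ∣ D), (cubicFieldCountOfDisc D : ℝ)) /
        (X : ℝ)) atTop (𝓝 (1 / (8 * Real.pi ^ 2))) := by
  have h := (tendsto_sum_posFundDiscrs_cubicFieldCountOfDisc_div h₂).sub hunr
  rw [show 1 / (2 * Real.pi ^ 2) - 3 / (8 * Real.pi ^ 2) = 1 / (8 * Real.pi ^ 2) by ring] at h
  refine h.congr fun X => ?_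
  rw [sum_posFundDiscrs_eq_sum_filter_three_dvd_add (fun D => (cubicFieldCountOfDisc D : ℝ)) X]
  ring

/-! ### The residual form: two named facts of the tree and one local count at `3` -/

/-- **`bv_threeTorsion_mean_localAtThree` from the two children of `btt_threeTorsion_sum` and ONE
count of cubic fields with a local condition at `3`.** Assume the CFT dictionary
(`threeTorsion_eq_two_mul_cubicFieldCountOfDisc_add_one`), BTT display (3)
(`btt_fundCubicFieldCount_sum`), and Theorem 36 (= [BST, Thm 8]) for the single family of totally
real cubic fields nowhere totally ramified in which `3` is (partially) ramified:
`#{K : 0 < Disc K < X fundamental, 3 ∣ Disc K} / X → 1/(8π²)`. Then Bhargava–Varma's Cor. 4 (b) at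
`3` holds in the tree's form: the mean of `#Cl₃(D)` over `0 < D < X` fundamental with `3 ∣ D`, and
with `3 ∤ D`, both tend to `4/3`. [cite: BhargavaVarma2016, §5.3–5.4 (proof of Cor. 4: Thm 36, (pont), Lemma 38)] -/
theorem bv_threeTorsion_mean_localAtThree_of_hasse_of_btt_of_three_dvd
    (h₁ : threeTorsion_eq_two_mul_cubicFieldCountOfDisc_add_one) (h₂ : btt_fundCubicFieldCount_sum)
    (hram : Tendsto (fun X : ℕ =>
      (∑ D ∈ (posFundDiscrs X).filter (fun D => (3 : ℤ) ∣ D), (cubicFieldCountOfDisc D : ℝ)) /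
        (X : ℝ)) atTop (𝓝 (1 / (8 * Real.pi ^ 2)))) :
    bv_threeTorsion_mean_localAtThree :=
  bv_threeTorsion_mean_localAtThree_of_hasse_of_cubicFieldCount h₁ hram
    (tendsto_cubicFieldCountOfDisc_not_three_dvd_of_three_dvd h₂ hram)

/-- The same with the unramified family as the input:
`#{K : 0 < Disc K < X fundamental, 3 ∤ Disc K} / X → 3/(8π²)` suffices.
[cite: BhargavaVarma2016, §5.3–5.4 (proof of Cor. 4)] -/
theorem bv_threeTorsion_mean_localAtThree_of_hasse_of_btt_of_not_three_dvd
    (h₁ : threeTorsion_eq_two_mul_cubicFieldCountOfDisc_add_one) (h₂ : btt_fundCubicFieldCount_sum)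
    (hunr : Tendsto (fun X : ℕ =>
      (∑ D ∈ (posFundDiscrs X).filter (fun D => ¬ (3 : ℤ) ∣ D), (cubicFieldCountOfDisc D : ℝ)) /
        (X : ℝ)) atTop (𝓝 (3 / (8 * Real.pi ^ 2)))) :
    bv_threeTorsion_mean_localAtThree :=
  bv_threeTorsion_mean_localAtThree_of_hasse_of_cubicFieldCount h₁
    (tendsto_cubicFieldCountOfDisc_three_dvd_of_not_three_dvd h₂ hunr) hunr

end Literature.NumberTheory.CubicFields

end
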